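import Mathlib.NumberTheory.Padics.RingHoms
import Mathlib.LinearAlgebra.Span.Basic
import Mathlib.LinearAlgebra.Quotient.Card
import Mathlib.GroupTheory.Index
import Mathlib.RingTheory.Finiteness.Basic
import HarnessLib

/-!
# Kato 2004, Prop. 14.16 (2) / Lemma 14.18 — the LOCAL INDEX `ν` at an additive prime:
# the lattice count behind `exp*_ω(H¹(ℚ_p, T_pE)) = c_p · p^{-t} · ℤ_p`, as abstract algebra

`Proofs` file (theorems only: no definition, no named fact, debt 0), topic
`NumberTheory/EllipticCurves`, sibling of `Kato2004/SelmerCountSkeletonProofs.lean` (the GLOBAL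
count of Prop. 14.16 (2) ⊕ Thm. 14.5 (3)) and of `Kato2004/AdditivePotGoodRankZeroShaUpperBound.lean`
(the named facts A154/A161 of the cell `bsd-rank1-residual` that READ K. Kato, *p-adic Hodge theory
and values of zeta functions of modular forms*, Astérisque 295 (2004), Thm. 14.5 (3) p. 236 +
Prop. 14.16 (2) p. 244 at an additive potentially good prime).

## What is proved (pure `ℤ_p`-module algebra; no elliptic curve occurs)

The "sharp" term of A161 — `ord_p #Ш(E)[p^∞] ≤ ord_p(L(E,1)/Ω_E) − v_p(c_p)` — rests on one
local computation (audit `KATO2004-TYPING.md` §14.2 row k′, derivation step D2): for `E/ℚ_p`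
minimal, additive, `p ≥ 3`, the formal logarithm `log_ω : E(ℚ_p) ⊗ ℤ_p → ℚ_p` has image
`p^{t − v_p(c_p)}ℤ_p`, where `p^t = #E(ℚ_p)[p^∞]`; dually (Kato p. 248, proof of Lemma 14.18, via
[BK2, Prop. 3.8]) `exp*_ω(H¹(ℚ_p, T_pE)) = p^{v_p(c_p) − t}ℤ_p = c_p·p^{−t}ℤ_p`, which is C.-H. Kim,
AJM 148 (2026) §3.2.3's display with `#Ẽ_ns(𝔽_p) = p`.  The inputs are a FILTRATION
`E₁ ≤ E₀ ≤ E(ℚ_p)⊗ℤ_p` with `log(E₁) = pℤ_p` (Silverman IV.6.4 (b), VII.2.2), `[E₀ : E₁] = #Ẽ_ns(𝔽_p) = p`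
(VII.2.1, VII.5.1 (c), C.16), `[E : E₀] = p^{v_p(c_p)}` (Kodaira–Néron VII.6.1), kernel of `log` =
the torsion, of order `p^t`, meeting `E₁` trivially.  This file proves the resulting count for an
ARBITRARY `ℤ_p`-linear map `L : M → ℚ_p` from a finitely generated `ℤ_p`-module with such a filtration
(`range_eq_span_zpow_of_filtration`: `L(M) = p^{t−v}ℤ_p`), after classifying the finitely generated
`ℤ_p`-submodules of `ℚ_p` (`exists_eq_span_zpow_of_fg`: they are the `p^nℤ_p`, `n ∈ ℤ`) and
computing their relative indices (`relIndex_span_zpow`: `[p^nℤ_p : p^mℤ_p] = p^{m−n}`), and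
records the index bookkeeping `[p^aℤ_p : ℤ_p z] = p^{ord_p z − a}` used to read Kato's
`ν = [H¹(ℚ_p,T)/H¹_f : z]·#H²(ℚ_p,T)^{-1}` (`relIndex_span_singleton_span_zpow`,
`nu_exponent_eq`).  What is NOT proved here (and is not algebra): the identifications of Kato's
objects with these modules (Bloch–Kato Example 3.11, Tate local duality / Kato p. 248) — derivation
step D1 of the audit.

HONEST FRAMING (cell `b2b-bsdres`): kernel support for a D-audit; no label of the rank-≤ 1 residual
census changes; nothing is booked by this file.

## References

* [Kato2004Asterisque] K. Kato, Astérisque 295 (2004): 14.17 (generalized index `[h]`, p. 247),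
  Lemma 14.18 and its proof (pp. 247–248), Prop. 14.16 (2) (p. 244), Prop. 14.21 (pp. 248–249).
* [BlochKato1990] S. Bloch, K. Kato, in *The Grothendieck Festschrift* I (1990), Prop. 3.8 (p. 354),
  Example 3.11 (p. 361).
* [Kim2022StructureSelmer] C.-H. Kim, Amer. J. Math. 148 (2026) = arXiv:2203.12159, §3.2.3.
* [SilvermanAEC2009] J. H. Silverman, *The Arithmetic of Elliptic Curves*, IV.6.4, VII.2.1–2.2,
  VII.5.1, VII.6.1, C.16.
-/

noncomputable section

open scoped Classical

namespace Literature.NumberTheory.EllipticCurves.Kato2004.LocalIndex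

variable {p : ℕ} [Fact p.Prime]

-- Throughout, `p^n ℤ_p ⊂ ℚ_p` (`n ∈ ℤ`) is written `Submodule.span ℤ_[p] {((p : ℚ_[p]) ^ (n : ℤ))}`.

/-! ### §1. The finitely generated `ℤ_p`-submodules of `ℚ_p` are the `p^n ℤ_p` -/

/-- `p ≠ 0` in `ℚ_p`. [folklore] -/
private theorem natCast_p_ne_zero : ((p : ℕ) : ℚ_[p]) ≠ 0 :=
  Nat.cast_ne_zero.mpr (Fact.out : p.Prime).ne_zero

/-- `p^n ≠ 0` in `ℚ_p`. [folklore] -/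
private theorem zpow_p_ne_zero (n : ℤ) : ((p : ℚ_[p]) ^ n) ≠ 0 :=
  zpow_ne_zero n natCast_p_ne_zero

/-- Every non-zero `x ∈ ℚ_p` is a `ℤ_p`-unit times `p^{ord_p x}`.
[cite: SerreLocalFields1979, Ch. I §3, Prop. 5 and its proof (fractional ideals of a DVR are the πⁿA, n ∈ ℤ)] -/
theorem exists_unit_smul_zpow_eq {x : ℚ_[p]} (hx : x ≠ 0) :
    ∃ u : ℤ_[p]ˣ, (u : ℤ_[p]) • ((p : ℚ_[p]) ^ x.valuation) = x := by
  have hw : ‖x * (p : ℚ_[p]) ^ (-x.valuation)‖ = 1 := by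
    rw [norm_mul, Padic.norm_eq_zpow_neg_valuation hx, Padic.norm_p_zpow, neg_neg, ← zpow_add₀]
    · simp
    · exact_mod_cast (Fact.out : p.Prime).ne_zero
  refine ⟨PadicInt.mkUnits hw, ?_⟩
  rw [Algebra.smul_def, PadicInt.algebraMap_apply, PadicInt.mkUnits_eq, mul_assoc, ← zpow_add₀
    natCast_p_ne_zero, neg_add_cancel, zpow_zero, mul_one]

/-- `ℤ_p · x = p^{ord_p x} ℤ_p` for `x ≠ 0` (principal fractional ideals of the DVR `ℤ_p`).
[cite: SerreLocalFields1979, Ch. I §3, Prop. 5 and its proof (fractional ideals of a DVR are the πⁿA, n ∈ ℤ)] -/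
theorem span_singleton_eq_span_zpow {x : ℚ_[p]} (hx : x ≠ 0) :
    Submodule.span ℤ_[p] {x} = (Submodule.span ℤ_[p] {((p : ℚ_[p]) ^ ((x.valuation : ℤ)))}) := by
  obtain ⟨u, hu⟩ := exists_unit_smul_zpow_eq hx
  rw [show Submodule.span ℤ_[p] {x} =
      Submodule.span ℤ_[p] {(u : ℤ_[p]) • ((p : ℚ_[p]) ^ x.valuation)} by rw [hu]]
  exact Submodule.span_singleton_smul_eq (M := ℚ_[p]) u.isUnit ((p : ℚ_[p]) ^ x.valuation)

/-- `p^m ∈ p^n ℤ_p ⟺ n ≤ m`. [cite: SerreLocalFields1979, Ch. I §3, Prop. 5 and its proof (fractional ideals of a DVR are the πⁿA, n ∈ ℤ)] -/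
theorem zpow_mem_span_zpow_iff {m n : ℤ} :
    ((p : ℚ_[p]) ^ m) ∈ (Submodule.span ℤ_[p] {((p : ℚ_[p]) ^ ((n : ℤ)))}) ↔ n ≤ m := by
  constructor
  · intro h
    obtain ⟨r, hr⟩ := Submodule.mem_span_singleton.mp h
    rw [Algebra.smul_def, PadicInt.algebraMap_apply] at hr
    have hr' : ((r : ℤ_[p]) : ℚ_[p]) = (p : ℚ_[p]) ^ (m - n) := by
      rw [zpow_sub₀ natCast_p_ne_zero, eq_div_iff (zpow_p_ne_zero n), hr]
    have h1 : ‖((r : ℤ_[p]) : ℚ_[p])‖ ≤ 1 := r.2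
    rw [hr', Padic.norm_p_zpow] at h1
    have hp1 : (1 : ℝ) < p := by exact_mod_cast (Fact.out : p.Prime).one_lt
    have := (zpow_le_one_iff_right₀ hp1).mp h1
    omega
  · intro h
    refine Submodule.mem_span_singleton.mpr ⟨((p : ℤ_[p]) ^ (m - n).toNat), ?_⟩
    rw [Algebra.smul_def, PadicInt.algebraMap_apply, PadicInt.coe_pow, PadicInt.coe_natCast,
      ← zpow_natCast, Int.toNat_of_nonneg (by omega), ← zpow_add₀ natCast_p_ne_zero]
    congr 1
    ring

/-- `p^m ℤ_p ⊆ p^n ℤ_p ⟺ n ≤ m`. [cite: SerreLocalFields1979, Ch. I §3, Prop. 5 and its proof (fractional ideals of a DVR are the πⁿA, n ∈ ℤ)] -/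
theorem span_zpow_le_iff {m n : ℤ} : (Submodule.span ℤ_[p] {((p : ℚ_[p]) ^ ((m : ℤ)))}) ≤ (Submodule.span ℤ_[p] {((p : ℚ_[p]) ^ ((n : ℤ)))}) ↔ n ≤ m := by
  rw [Submodule.span_singleton_le_iff_mem]
  exact zpow_mem_span_zpow_iff

/-- `p^a ℤ_p + p^b ℤ_p = p^{min(a,b)} ℤ_p`. [cite: SerreLocalFields1979, Ch. I §3, Prop. 5 and its proof (fractional ideals of a DVR are the πⁿA, n ∈ ℤ)] -/
theorem span_zpow_sup_span_zpow (a b : ℤ) : (Submodule.span ℤ_[p] {((p : ℚ_[p]) ^ ((a : ℤ)))}) ⊔ (Submodule.span ℤ_[p] {((p : ℚ_[p]) ^ ((b : ℤ)))}) = (Submodule.span ℤ_[p] {((p : ℚ_[p]) ^ ((min a b : ℤ)))}) := by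
  apply le_antisymm
  · exact sup_le (span_zpow_le_iff.mpr (min_le_left a b)) (span_zpow_le_iff.mpr (min_le_right a b))
  · rcases min_choice a b with h | h <;> rw [h]
    · exact le_sup_left
    · exact le_sup_right

/-- **The finitely generated non-zero `ℤ_p`-submodules of `ℚ_p` are exactly the `p^n ℤ_p`,
`n ∈ ℤ`** — Serre, *Local Fields*, Ch. I §3, proof of Prop. 5: "[a fractional ideal 𝔞 of A is a
sub-A-module of K finitely generated over A] … In a discrete valuation ring, a fractional ideal has
the form πⁿA, where n ∈ ℤ". [cite: SerreLocalFields1979, Ch. I §3, Prop. 5 and its proof (fractional ideals of a DVR are the πⁿA, n ∈ ℤ)] -/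
theorem exists_eq_span_zpow_of_fg {Λ : Submodule ℤ_[p] ℚ_[p]} (hfg : Λ.FG) (hne : Λ ≠ ⊥) :
    ∃ n : ℤ, Λ = (Submodule.span ℤ_[p] {((p : ℚ_[p]) ^ ((n : ℤ)))}) := by
  obtain ⟨s, rfl⟩ := hfg
  -- induction on the finite generating set
  have key : ∀ s : Finset ℚ_[p], Submodule.span ℤ_[p] (s : Set ℚ_[p]) = ⊥ ∨
      ∃ n : ℤ, Submodule.span ℤ_[p] (s : Set ℚ_[p]) = (Submodule.span ℤ_[p] {((p : ℚ_[p]) ^ ((n : ℤ)))}) := by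
    intro s
    induction s using Finset.induction_on with
    | empty => exact Or.inl (by simp)
    | insert x s hxs ih =>
      rw [Finset.coe_insert, Submodule.span_insert]
      by_cases hx : x = 0
      · subst hx
        rw [Submodule.span_zero_singleton, bot_sup_eq]
        exact ih
      · right
        rw [span_singleton_eq_span_zpow hx]
        rcases ih with h | ⟨n, hn⟩
        · exact ⟨x.valuation, by rw [h, sup_bot_eq]⟩
        · exact ⟨min x.valuation n, by rw [hn, span_zpow_sup_span_zpow]⟩
  rcases key s with h | h
  · exact absurd h hne
  · exact h

/-! ### §2. Indices: `[p^n ℤ_p : p^m ℤ_p] = p^{m-n}` -/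

/-- `#(ℤ_p / p^k ℤ_p) = p^k` (via `ℤ_p/p^k ≅ ℤ/p^k`, `PadicInt.toZModPow`).
[cite: Kato2004Asterisque, 14.17 (generalized index [h], p. 247)] [cite: SerreLocalFields1979, Ch. II §3 (ℤ_p)] -/
theorem index_span_pow (k : ℕ) :
    (Ideal.span {((p : ℤ_[p]) ^ k)}).toAddSubgroup.index = p ^ k := by
  rw [AddSubgroup.index_eq_card]
  have hsurj : Function.Surjective (PadicInt.toZModPow k : ℤ_[p] →+* ZMod (p ^ k)) :=
    ZMod.ringHom_surjective _
  have e := (RingHom.quotientKerEquivOfSurjective hsurj).toEquiv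
  rw [PadicInt.ker_toZModPow] at e
  change Nat.card (ℤ_[p] ⧸ Ideal.span {((p : ℤ_[p]) ^ k)}) = p ^ k
  rw [Nat.card_congr e, Nat.card_zmod]

/-- **`[p^n ℤ_p : p^m ℤ_p] = p^{m−n}` for `n ≤ m`** (relative index of additive subgroups of
`ℚ_p`); Kato's generalized index `[p^m ℤ_p ⇢ p^n ℤ_p]` of 14.17. [cite: Kato2004Asterisque, 14.17 (generalized index [h], p. 247)] [cite: SerreLocalFields1979, Ch. I §3, Prop. 5 and its proof (fractional ideals of a DVR are the πⁿA, n ∈ ℤ)] -/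
theorem relIndex_span_zpow {m n : ℤ} (h : n ≤ m) :
    (Submodule.span ℤ_[p] {((p : ℚ_[p]) ^ ((m : ℤ)))}).toAddSubgroup.relIndex (Submodule.span ℤ_[p] {((p : ℚ_[p]) ^ ((n : ℤ)))}).toAddSubgroup = p ^ (m - n).toNat := by
  -- the linear isomorphism `ℤ_p → p^n ℤ_p`, `r ↦ r • p^n`
  set φ : ℤ_[p] →ₗ[ℤ_[p]] ℚ_[p] := LinearMap.toSpanSingleton ℤ_[p] ℚ_[p] ((p : ℚ_[p]) ^ n) with hφ
  have hinj : Function.Injective φ := by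
    intro a b hab
    simp only [hφ, LinearMap.toSpanSingleton_apply] at hab
    exact_mod_cast (smul_left_injective ℤ_[p] (zpow_p_ne_zero n) hab : a = b)
  have hn : (Submodule.span ℤ_[p] {((p : ℚ_[p]) ^ ((n : ℤ)))}) = (⊤ : Submodule ℤ_[p] ℤ_[p]).map φ := by
    rw [Submodule.map_top, hφ, LinearMap.range_toSpanSingleton]
  have hm : (Submodule.span ℤ_[p] {((p : ℚ_[p]) ^ ((m : ℤ)))}) =
      Submodule.map φ (Submodule.span ℤ_[p] {((p : ℤ_[p]) ^ (m - n).toNat)}) := by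
    rw [Submodule.map_span, Set.image_singleton, hφ, LinearMap.toSpanSingleton_apply,
      Algebra.smul_def, PadicInt.algebraMap_apply, PadicInt.coe_pow, PadicInt.coe_natCast,
      ← zpow_natCast, Int.toNat_of_nonneg (by omega), ← zpow_add₀ natCast_p_ne_zero]
    congr 2
    ring
  rw [hn, hm, Submodule.map_toAddSubgroup, Submodule.map_toAddSubgroup,
    AddSubgroup.relIndex_map_map_of_injective _ _ hinj, Submodule.top_toAddSubgroup,
    AddSubgroup.relIndex_top_right, Ideal.submodule_span_eq, index_span_pow]

/-- **A finitely generated `ℤ_p`-submodule of `ℚ_p` containing `p^a ℤ_p` with index `p^k` is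
`p^{a−k} ℤ_p`.** [cite: SerreLocalFields1979, Ch. I §3, Prop. 5 and its proof (fractional ideals of a DVR are the πⁿA, n ∈ ℤ)] [cite: Kato2004Asterisque, 14.17 (generalized index [h], p. 247)] -/
theorem eq_span_zpow_of_relIndex {Λ : Submodule ℤ_[p] ℚ_[p]} (hfg : Λ.FG) {a : ℤ}
    (hle : (Submodule.span ℤ_[p] {((p : ℚ_[p]) ^ ((a : ℤ)))}) ≤ Λ) {k : ℕ} (hidx : (Submodule.span ℤ_[p] {((p : ℚ_[p]) ^ ((a : ℤ)))}).toAddSubgroup.relIndex Λ.toAddSubgroup = p ^ k) :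
    Λ = (Submodule.span ℤ_[p] {((p : ℚ_[p]) ^ ((a - k : ℤ)))}) := by
  have hne : Λ ≠ ⊥ := by
    intro h
    rw [h, le_bot_iff, Submodule.span_singleton_eq_bot] at hle
    exact zpow_p_ne_zero a hle
  obtain ⟨n, rfl⟩ := exists_eq_span_zpow_of_fg hfg hne
  have hna : n ≤ a := span_zpow_le_iff.mp hle
  rw [relIndex_span_zpow hna] at hidx
  have hk : (a - n).toNat = k :=
    Nat.pow_right_injective (Fact.out : p.Prime).two_le hidx
  have hn : n = a - (k : ℤ) := by
    rw [← hk, Int.toNat_of_nonneg (by omega)]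
    ring
  rw [hn]

/-- **Index bookkeeping for `ν`**: for `0 ≠ z ∈ p^a ℤ_p`, `[p^a ℤ_p : ℤ_p z] = p^{ord_p z − a}`.
(Kato 14.17: `[M : z]` for `M` free of rank one, read in the coordinate of `ℚ_p`.)
[cite: Kato2004Asterisque, 14.17 (p. 247), Thm. 14.5 definition of [M : z] (p. 237)] -/
theorem relIndex_span_singleton_span_zpow {z : ℚ_[p]} (hz : z ≠ 0) {a : ℤ}
    (hmem : z ∈ (Submodule.span ℤ_[p] {((p : ℚ_[p]) ^ ((a : ℤ)))})) :
    (Submodule.span ℤ_[p] {z}).toAddSubgroup.relIndex (Submodule.span ℤ_[p] {((p : ℚ_[p]) ^ ((a : ℤ)))}).toAddSubgroup =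
      p ^ (z.valuation - a).toNat := by
  have hle : a ≤ z.valuation := by
    have := (Submodule.span_singleton_le_iff_mem _ _).mpr hmem
    rw [span_singleton_eq_span_zpow hz] at this
    exact span_zpow_le_iff.mp this
  rw [span_singleton_eq_span_zpow hz, relIndex_span_zpow hle]

/-! ### §3. The filtration count: `L(M) = p^{t−v} ℤ_p` -/

/-- **The local lattice count** (the arithmetic of derivation step D2 in the cell's audit of A161).
Let `M` be a finitely generated `ℤ_p`-module, `L : M → ℚ_p` a `ℤ_p`-linear map whose kernel is finite
of order `p^t`, and `M₁ ≤ M₀ ≤ M` submodules with `M₁ ∩ ker L = 0`, `[M₀ : M₁] = p`,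
`[M : M₀] = p^v` and `L(M₁) = p ℤ_p`.  Then `t ≤ 1 + v` and `L(M) = p^{t−v} ℤ_p`.
(For `E/ℚ_p` minimal, additive, `p ≥ 3`: `M = E(ℚ_p) ⊗ ℤ_p`, `M₀ = E₀`, `M₁ = E₁ ≅_{log} pℤ_p`,
`[E₀:E₁] = #Ẽ_ns(𝔽_p) = p`, `[E:E₀] = p^{v_p(c_p)}`, `ker log = E(ℚ_p)[p^∞]` of order `p^t` —
Silverman IV.6.4 (b), VII.2.1–2.2, VII.5.1 (c), C.16, VII.6.1 — giving `log_ω(E(ℚ_p)⊗ℤ_p) =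
p^{t−v_p(c_p)}ℤ_p`, whence by Tate duality `exp*_ω(H¹(ℚ_p,T_pE)) = p^{v_p(c_p)−t}ℤ_p`, Kato p. 248 /
Kim §3.2.3.) [cite: Kato2004Asterisque, Lemma 14.18 proof (p. 248), Prop. 14.21 (pp. 248–249)]
[cite: SilvermanAEC2009, IV.6.4 (b), VII.2.1, VII.2.2, VII.6.1] [cite: Kim2022StructureSelmer, §3.2.3 (PDF p. 16)] -/
theorem range_eq_span_zpow_of_filtration {M : Type*} [AddCommGroup M] [Module ℤ_[p] M]
    [Module.Finite ℤ_[p] M] (L : M →ₗ[ℤ_[p]] ℚ_[p]) (M₁ M₀ : Submodule ℤ_[p] M) (h10 : M₁ ≤ M₀)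
    {t v : ℕ} (hker : Nat.card (LinearMap.ker L) = p ^ t)
    (hdisj : M₁ ⊓ LinearMap.ker L = ⊥)
    (h01 : M₁.toAddSubgroup.relIndex M₀.toAddSubgroup = p)
    (hv : M₀.toAddSubgroup.index = p ^ v)
    (hL1 : M₁.map L = (Submodule.span ℤ_[p] {((p : ℚ_[p]) ^ ((1 : ℤ)))})) :
    t ≤ 1 + v ∧ LinearMap.range L = (Submodule.span ℤ_[p] {((p : ℚ_[p]) ^ (((t : ℤ) - v : ℤ)))}) := by
  set K : Submodule ℤ_[p] M := LinearMap.ker L with hK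
  -- `[M : M₁] = p^{1+v}`
  have hM1 : M₁.toAddSubgroup.index = p ^ (1 + v) := by
    rw [← AddSubgroup.relIndex_mul_index (Submodule.toAddSubgroup_mono h10), h01, hv]
    ring
  -- `[M₁ + K : M₁] = #K = p^t`
  have hM1K : M₁.toAddSubgroup.relIndex (M₁ ⊔ K).toAddSubgroup = p ^ t := by
    have hinf : M₁.toAddSubgroup ⊓ K.toAddSubgroup = ⊥ := by
      have : (M₁ ⊓ K).toAddSubgroup = M₁.toAddSubgroup ⊓ K.toAddSubgroup := by
        ext x
        simp only [Submodule.mem_toAddSubgroup, AddSubgroup.mem_inf, Submodule.mem_inf]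
      rw [← this, hdisj, Submodule.bot_toAddSubgroup]
    rw [Submodule.sup_toAddSubgroup, AddSubgroup.relIndex_sup_left, ← AddSubgroup.inf_relIndex_right,
      hinf, AddSubgroup.relIndex_bot_left, ← hker]
    rfl
  -- `[M : M₁ + K] = p^{1+v-t}`
  have hsplit : M₁.toAddSubgroup.index =
      M₁.toAddSubgroup.relIndex (M₁ ⊔ K).toAddSubgroup * (M₁ ⊔ K).toAddSubgroup.index :=
    (AddSubgroup.relIndex_mul_index
      (Submodule.toAddSubgroup_mono (le_sup_left : M₁ ≤ M₁ ⊔ K))).symm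
  rw [hM1, hM1K] at hsplit
  have htle : t ≤ 1 + v := by
    have hdvd : p ^ t ∣ p ^ (1 + v) := Dvd.intro _ hsplit.symm
    exact (Nat.pow_dvd_pow_iff_le_right (Fact.out : p.Prime).one_lt).mp hdvd
  have hidx : (M₁ ⊔ K).toAddSubgroup.index = p ^ (1 + v - t) := by
    have hpt : 0 < p ^ t := pow_pos (Fact.out : p.Prime).pos t
    have : p ^ (1 + v) = p ^ t * p ^ (1 + v - t) := by
      rw [← pow_add, Nat.add_sub_cancel' htle]
    rw [this] at hsplit
    exact (Nat.eq_of_mul_eq_mul_left hpt hsplit).symm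
  -- transport along `L`: `[L(M) : L(M₁)] = [M : M₁ + K]`
  have hrel : (Submodule.span ℤ_[p] {((p : ℚ_[p]) ^ ((1 : ℤ)))}).toAddSubgroup.relIndex (LinearMap.range L).toAddSubgroup = p ^ (1 + v - t) := by
    rw [← hL1, Submodule.map_toAddSubgroup, ← Submodule.map_top, Submodule.map_toAddSubgroup,
      AddSubgroup.relIndex_map_map, Submodule.top_toAddSubgroup, top_sup_eq,
      AddSubgroup.relIndex_top_right]
    have hk : (L : M →+ ℚ_[p]).ker = K.toAddSubgroup := by
      rw [hK, LinearMap.ker_toAddSubgroup]; rfl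
    rw [hk, ← Submodule.sup_toAddSubgroup, hidx]
  -- `L(M)` is finitely generated and contains `p ℤ_p`
  have hfg : (LinearMap.range L).FG := by
    rw [← Submodule.map_top]
    exact Submodule.FG.map _ Module.Finite.fg_top
  have hle : (Submodule.span ℤ_[p] {((p : ℚ_[p]) ^ ((1 : ℤ)))}) ≤ LinearMap.range L := by
    rw [← hL1]; exact LinearMap.map_le_range
  refine ⟨htle, ?_⟩
  have := eq_span_zpow_of_relIndex hfg hle hrel
  rw [this, Nat.cast_sub htle]
  push_cast
  ring_nf

/-- **The exponent of Kato's `ν`** (bookkeeping; Kato Prop. 14.16 (2), p. 244: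
`ν = [H¹(ℚ_p,T)/H¹_f(ℚ_p,T) : z]·#H²(ℚ_p,T)^{-1}`).  If `exp*_ω` maps the rank-one lattice
`H¹/H¹_f` isomorphically onto `p^{c−t}ℤ_p ⊂ ℚ_p` (the dual of the count above, `c = v_p(c_p)`), if
`exp*_ω(z)` has `p`-adic order `e`, and if `#H²(ℚ_p,T) = p^t`, then
`[H¹/H¹_f : z] = p^{e − (c − t)}` and `ν·p^t = [H¹/H¹_f : z]`, so `ν = p^{e − c}`: in exponents,
`(e − (c − t)) − t = e − c`.  Stated on the `ℚ_p`-side: for `0 ≠ w ∈ p^{c−t}ℤ_p` of order `e`,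
`[p^{c−t}ℤ_p : ℤ_p w] = p^{e−c+t}` (so `e − c + t ≥ 0`) and `(e − c + t) − t = e − c`; the statement
records the index together with this exponent arithmetic. [cite: Kato2004Asterisque, Prop. 14.16 (2) (p. 244), Prop. 14.21 (1) and its proof (pp. 248–249)] -/
theorem nu_exponent_eq {w : ℚ_[p]} (hw : w ≠ 0) {c t : ℤ} (hmem : w ∈ (Submodule.span ℤ_[p] {((p : ℚ_[p]) ^ ((c - t : ℤ)))})) :
    (Submodule.span ℤ_[p] {w}).toAddSubgroup.relIndex (Submodule.span ℤ_[p] {((p : ℚ_[p]) ^ ((c - t : ℤ)))}).toAddSubgroup =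
        p ^ (w.valuation - (c - t)).toNat ∧
      ((w.valuation - (c - t)).toNat : ℤ) - t = w.valuation - c := by
  refine ⟨relIndex_span_singleton_span_zpow hw hmem, ?_⟩
  have hle : c - t ≤ w.valuation := by
    have := (Submodule.span_singleton_le_iff_mem _ _).mpr hmem
    rw [span_singleton_eq_span_zpow hw] at this
    exact span_zpow_le_iff.mp this
  rw [Int.toNat_of_nonneg (by omega)]
  ring

end Literature.NumberTheory.EllipticCurves.Kato2004.LocalIndex

end
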